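import Summits.KontsevichZagierPeriods.KontsevichZagierPeriods.Theorems.UnfoldedStokesStokesGenerationFibrewiseRungDlogSector
import Mathlib.MeasureTheory.Integral.IntervalIntegral.FundThmCalculus
import Mathlib.MeasureTheory.Integral.DominatedConvergence
import Mathlib.MeasureTheory.Function.LocallyIntegrable
import Mathlib.Analysis.SpecialFunctions.ExpDeriv
import Mathlib.Analysis.Complex.RealDeriv
import Mathlib.Analysis.Calculus.Deriv.Polynomial
import Mathlib.Topology.Algebra.Polynomial
import Mathlib.RingTheory.Algebraic.Basic
import Mathlib.FieldTheory.AlgebraicClosure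

/-!
# `StokesGeneration` (stmt-KontsevichZagierPeriods-3586) — line `fibrewise_stokes`, stub `stub_loopAngleExp`

Registered rung stub W1 (rung 8) of the line `fibrewise_stokes` of the crux `StokesGeneration`
(route UnfoldedStokes): **the exponential of the total angle of a polynomial loop is algebraic**.

For a complex polynomial loop `P = A + iB` (`A`, `B` real polynomials with real algebraic
coefficients) without zeros on `[0,1]`, the total angle is
`Θ = ∫₀¹ Im (P'/P) = ∫₀¹ (A B' − A' B)/(A² + B²)`, and `e^{iΘ}` is an algebraic number: it is
the unit vector `(P(1)/|P(1)|)/(P(0)/|P(0)|)`.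

Proof. Let `T(x) = ∫₀ˣ (A B' − A' B)/(A² + B²)` (so `T' = Im (P'/P)` on `(0,1)` by FTC-1) and
`g(x) = conj(P(x)) · e^{2iT(x)} / P(x)`. Since
`(conj P/P)'/(conj P/P) = conj(P')/conj(P) − P'/P = −2i·Im(P'/P)`, the derivative of `g` vanishes
on `(0,1)`; `g` is continuous on `[0,1]`, so `g(1) = g(0)` (FTC-2 with zero derivative), i.e.
`e^{2iΘ} = conj(P(0)) P(1) / (P(0) conj(P(1)))`, an element of the field `ℚ̄ ∩ ℂ` of algebraic
numbers (`A(0), A(1), B(0), B(1)` are real algebraic and `i² = −1`). Hence `(e^{iΘ})² = e^{2iΘ}`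
is algebraic and so is `e^{iΘ}`.

References: M. Kontsevich, D. Zagier, *Periods* (2001), §1.1–1.2 (`π` and arguments of algebraic
numbers as periods; the Stokes/Newton–Leibniz rule); the computation itself is folklore calculus.
-/

noncomputable section

set_option linter.dupNamespace false

namespace Summit.KontsevichZagierPeriods.KontsevichZagierPeriods.Cruxes.StokesGeneration.FibrewiseStokes

open MeasureTheory Set
open Complex (I exp)

/-- Continuity of the angular integrand `Im (P'/P) = (A B' − A' B)/(A² + B²)` of the loop
`P = A + iB` on a set where `A² + B²` does not vanish. [folklore] -/
theorem loopAngle_integrand_continuousOn (A B : Polynomial ℝ) {t : Set ℝ}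
    (hne : ∀ u ∈ t, A.eval u ^ 2 + B.eval u ^ 2 ≠ 0) :
    ContinuousOn (fun u =>
      (A.eval u * (Polynomial.derivative B).eval u
          - (Polynomial.derivative A).eval u * B.eval u) /
        (A.eval u ^ 2 + B.eval u ^ 2)) t := by
  refine ContinuousOn.div ?_ ?_ hne
  · exact (A.continuousOn.mul (Polynomial.derivative B).continuousOn).sub
      ((Polynomial.derivative A).continuousOn.mul B.continuousOn)
  · exact (A.continuousOn.pow 2).add (B.continuousOn.pow 2)

/-- A point `a + b i` of the loop with `a² + b² ≠ 0` is a non-zero complex number. [folklore] -/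
theorem loopAngle_point_ne_zero {a b : ℝ} (h : a ^ 2 + b ^ 2 ≠ 0) :
    (a : ℂ) + (b : ℂ) * I ≠ 0 := by
  intro h0
  have hre : a = 0 := by simpa using congrArg Complex.re h0
  have him : b = 0 := by simpa using congrArg Complex.im h0
  exact h (by rw [hre, him]; norm_num)

/-- The conjugate point `a − b i` of the loop with `a² + b² ≠ 0` is a non-zero complex number.
[folklore] -/
theorem loopAngle_conjPoint_ne_zero {a b : ℝ} (h : a ^ 2 + b ^ 2 ≠ 0) :
    (a : ℂ) - (b : ℂ) * I ≠ 0 := by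
  have h' : a ^ 2 + (-b) ^ 2 ≠ 0 := by rwa [neg_sq]
  have := loopAngle_point_ne_zero h'
  rwa [Complex.ofReal_neg, neg_mul, ← sub_eq_add_neg] at this

/-- FTC-1 for the angle primitive: if `w` is continuous on `[0,1]`, then `x ↦ ∫₀ˣ w` has
derivative `w x` at every interior point `x ∈ (0,1)`. [folklore] -/
theorem loopAngle_primitive_hasDerivAt {w : ℝ → ℝ} (hw : ContinuousOn w (Icc (0:ℝ) 1))
    {x : ℝ} (hx : x ∈ Ioo (0:ℝ) 1) :
    HasDerivAt (fun y => ∫ u in (0:ℝ)..y, w u) (w x) x := by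
  refine intervalIntegral.integral_hasDerivAt_right ?_ ?_ ?_
  · refine (hw.mono ?_).intervalIntegrable
    rw [uIcc_of_le hx.1.le]
    exact Icc_subset_Icc_right hx.2.le
  · exact ContinuousOn.stronglyMeasurableAtFilter isOpen_Ioo (hw.mono Ioo_subset_Icc_self) x hx
  · exact hw.continuousAt (Icc_mem_nhds hx.1 hx.2)

/-- Continuity of the angle primitive `x ↦ ∫₀ˣ w` on `[0,1]` for `w` continuous on `[0,1]`.
[folklore] -/
theorem loopAngle_primitive_continuousOn {w : ℝ → ℝ} (hw : ContinuousOn w (Icc (0:ℝ) 1)) :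
    ContinuousOn (fun y => ∫ u in (0:ℝ)..y, w u) (Icc (0:ℝ) 1) := by
  have hw' : ContinuousOn w (uIcc (0:ℝ) 1) := by rwa [uIcc_of_le zero_le_one]
  have := intervalIntegral.continuousOn_primitive_interval (μ := volume) hw'.integrableOn_uIcc
  rwa [uIcc_of_le zero_le_one] at this

/-- **The rotating frame is constant (derivative).** For the loop `P = A + iB` and any real
function `T` with `T'(x) = w`, `w · (A² + B²)(x) = (A B' − A' B)(x)` and `(A² + B²)(x) ≠ 0`,
the function `conj(P) · e^{2iT} / P` has zero derivative at `x`
(`conj(P)'/conj(P) − P'/P = −2i Im(P'/P)`). [folklore] -/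
theorem loopAngle_frame_hasDerivAt (A B : Polynomial ℝ) {T : ℝ → ℝ} {w x : ℝ}
    (hT : HasDerivAt T w x)
    (hw : w * (A.eval x ^ 2 + B.eval x ^ 2) =
      A.eval x * (Polynomial.derivative B).eval x - (Polynomial.derivative A).eval x * B.eval x)
    (hx : A.eval x ^ 2 + B.eval x ^ 2 ≠ 0) :
    HasDerivAt (fun y : ℝ => (((A.eval y : ℝ) : ℂ) - ((B.eval y : ℝ) : ℂ) * I) *
        exp (2 * ((T y : ℝ) : ℂ) * I) / (((A.eval y : ℝ) : ℂ) + ((B.eval y : ℝ) : ℂ) * I))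
      0 x := by
  have hA : HasDerivAt (fun y : ℝ => ((A.eval y : ℝ) : ℂ))
      (((Polynomial.derivative A).eval x : ℝ) : ℂ) x :=
    (A.hasDerivAt x).ofReal_comp
  have hB : HasDerivAt (fun y : ℝ => ((B.eval y : ℝ) : ℂ))
      (((Polynomial.derivative B).eval x : ℝ) : ℂ) x :=
    (B.hasDerivAt x).ofReal_comp
  have hP := hA.fun_add (hB.mul_const I)
  have hPbar := hA.fun_sub (hB.mul_const I)
  have hE := ((hT.ofReal_comp.const_mul (2:ℂ)).mul_const I).cexp
  have hg := (hPbar.fun_mul hE).fun_div hP (loopAngle_point_ne_zero hx)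
  refine hg.congr_deriv ?_
  have hPP : (((A.eval x : ℝ) : ℂ) + ((B.eval x : ℝ) : ℂ) * I) *
        (((A.eval x : ℝ) : ℂ) - ((B.eval x : ℝ) : ℂ) * I)
      = ((A.eval x : ℝ) : ℂ) ^ 2 + ((B.eval x : ℝ) : ℂ) ^ 2 := by
    linear_combination (-(((B.eval x : ℝ) : ℂ)) ^ 2) * Complex.I_sq
  have hwC : (w : ℂ) * (((A.eval x : ℝ) : ℂ) ^ 2 + ((B.eval x : ℝ) : ℂ) ^ 2) =
      ((A.eval x : ℝ) : ℂ) * (((Polynomial.derivative B).eval x : ℝ) : ℂ)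
        - (((Polynomial.derivative A).eval x : ℝ) : ℂ) * ((B.eval x : ℝ) : ℂ) := by
    exact_mod_cast hw
  rw [div_eq_zero_iff]
  left
  linear_combination (2 * exp (2 * ((T x : ℝ) : ℂ) * I) * (w : ℂ) * I) * hPP
    + (2 * exp (2 * ((T x : ℝ) : ℂ) * I) * I) * hwC

/-- **The rotating frame is constant (continuity).** For the loop `P = A + iB` without zeros on
`[0,1]` and `T` continuous on `[0,1]`, the function `conj(P) · e^{2iT} / P` is continuous on
`[0,1]`. [folklore] -/
theorem loopAngle_frame_continuousOn (A B : Polynomial ℝ) {T : ℝ → ℝ}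
    (hT : ContinuousOn T (Icc (0:ℝ) 1))
    (hne : ∀ u ∈ Icc (0:ℝ) 1, A.eval u ^ 2 + B.eval u ^ 2 ≠ 0) :
    ContinuousOn (fun y : ℝ => (((A.eval y : ℝ) : ℂ) - ((B.eval y : ℝ) : ℂ) * I) *
        exp (2 * ((T y : ℝ) : ℂ) * I) / (((A.eval y : ℝ) : ℂ) + ((B.eval y : ℝ) : ℂ) * I))
      (Icc (0:ℝ) 1) := by
  have hA : Continuous (fun y : ℝ => ((A.eval y : ℝ) : ℂ)) :=
    Complex.continuous_ofReal.comp A.continuous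
  have hB : Continuous (fun y : ℝ => ((B.eval y : ℝ) : ℂ)) :=
    Complex.continuous_ofReal.comp B.continuous
  refine ContinuousOn.div ?_ ?_ (fun u hu => loopAngle_point_ne_zero (hne u hu))
  · refine (hA.sub (hB.mul continuous_const)).continuousOn.mul ?_
    refine Complex.continuous_exp.comp_continuousOn ?_
    exact (continuousOn_const.mul (Complex.continuous_ofReal.comp_continuousOn hT)).mul
      continuousOn_const
  · exact (hA.add (hB.mul continuous_const)).continuousOn

/-- A function `[0,1] → ℂ` continuous on `[0,1]` with zero derivative on `(0,1)` takes equal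
values at the endpoints (FTC-2 with the zero integrand). [folklore] -/
theorem loopAngle_eq_of_hasDerivAt_zero {g : ℝ → ℂ} (hc : ContinuousOn g (Icc (0:ℝ) 1))
    (hd : ∀ x ∈ Ioo (0:ℝ) 1, HasDerivAt g 0 x) : g 1 = g 0 := by
  have h := intervalIntegral.integral_eq_sub_of_hasDerivAt_of_le (f' := fun _ => (0:ℂ))
    zero_le_one hc hd intervalIntegrable_const
  rw [intervalIntegral.integral_zero] at h
  exact sub_eq_zero.mp h.symm

/-- The value at a rational point of a real polynomial with real algebraic coefficients lies in
the field `ℚ̄ ∩ ℂ` of complex algebraic numbers (its complexification is algebraic).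
[folklore] -/
theorem loopAngle_eval_mem_algebraicClosure (f : Polynomial ℝ)
    (hf : ∀ n, IsAlgebraic ℚ (f.coeff n)) (r : ℚ) :
    ((f.eval (r : ℝ) : ℝ) : ℂ) ∈ algebraicClosure ℚ ℂ := by
  have h : IsAlgebraic ℚ ((f.eval (r : ℝ) : ℝ) : ℂ) := by
    simpa using (isAlgebraic_eval_ratCast f hf r).algebraMap (A := ℂ)
  exact mem_algebraicClosure_iff.mpr h

/-- **Registered stub `stub_loopAngleExp` (W1, rung 8 of the line `fibrewise_stokes`): the
exponential of the total angle of a polynomial loop is algebraic.** For a complex polynomial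
loop `P = A + iB` with real algebraic coefficients and no zeros on `[0,1]`, with total angle
`Θ = ∫₀¹ Im (P'/P) = ∫₀¹ (A B' − A' B)/(A² + B²)`, the number `e^{iΘ}` is algebraic: the
rotating frame `conj(P) e^{2iT}/P` (`T` the angle primitive) is constant on `[0,1]`, whence
`e^{2iΘ} = conj(P(0)) P(1)/(P(0) conj(P(1))) ∈ ℚ̄`, and a square root of an algebraic number is
algebraic. [folklore] [cite: KontsevichZagier2001, §1.2] -/
theorem stub_loopAngleExp :
    ∀ (A B : Polynomial ℝ), (∀ n, IsAlgebraic ℚ (A.coeff n)) → (∀ n, IsAlgebraic ℚ (B.coeff n)) →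
      (∀ u ∈ Set.Icc (0:ℝ) 1, A.eval u ^ 2 + B.eval u ^ 2 ≠ 0) →
      IsAlgebraic ℚ (Complex.exp (((∫ u in (0:ℝ)..1,
        (A.eval u * (Polynomial.derivative B).eval u - (Polynomial.derivative A).eval u * B.eval u) /
          (A.eval u ^ 2 + B.eval u ^ 2) : ℝ) : ℂ) * Complex.I)) := by
  intro A B hA hB hne
  set w : ℝ → ℝ := fun u =>
    (A.eval u * (Polynomial.derivative B).eval u - (Polynomial.derivative A).eval u * B.eval u) /
      (A.eval u ^ 2 + B.eval u ^ 2) with hw_def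
  set T : ℝ → ℝ := fun y => ∫ u in (0:ℝ)..y, w u with hT_def
  -- the angle primitive `T` and the rotating frame `conj(P) e^{2iT}/P`
  have hwc : ContinuousOn w (Icc (0:ℝ) 1) := loopAngle_integrand_continuousOn A B hne
  have hTc : ContinuousOn T (Icc (0:ℝ) 1) := loopAngle_primitive_continuousOn hwc
  have hgd : ∀ x ∈ Ioo (0:ℝ) 1,
      HasDerivAt (fun y : ℝ => (((A.eval y : ℝ) : ℂ) - ((B.eval y : ℝ) : ℂ) * I) *
        exp (2 * ((T y : ℝ) : ℂ) * I) / (((A.eval y : ℝ) : ℂ) + ((B.eval y : ℝ) : ℂ) * I)) 0 x := by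
    intro x hx
    have hxne := hne x (Ioo_subset_Icc_self hx)
    exact loopAngle_frame_hasDerivAt A B (loopAngle_primitive_hasDerivAt hwc hx)
      (div_mul_cancel₀ _ hxne) hxne
  have h10 := loopAngle_eq_of_hasDerivAt_zero (loopAngle_frame_continuousOn A B hTc hne) hgd
  -- evaluate the frame at the endpoints: `e^{2iΘ} = conj(P(0)) P(1)/(P(0) conj(P(1)))`
  have hT0 : T 0 = 0 := intervalIntegral.integral_same
  simp only [hT0, Complex.ofReal_zero, mul_zero, zero_mul, Complex.exp_zero, mul_one] at h10
  have h1 := hne 1 ⟨zero_le_one, le_rfl⟩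
  have hP1 := loopAngle_point_ne_zero h1
  have hQ1 := loopAngle_conjPoint_ne_zero h1
  have hE : exp (2 * ((T 1 : ℝ) : ℂ) * I) =
      (((A.eval 0 : ℝ) : ℂ) - ((B.eval 0 : ℝ) : ℂ) * I)
        / (((A.eval 0 : ℝ) : ℂ) + ((B.eval 0 : ℝ) : ℂ) * I)
        * (((A.eval 1 : ℝ) : ℂ) + ((B.eval 1 : ℝ) : ℂ) * I)
        / (((A.eval 1 : ℝ) : ℂ) - ((B.eval 1 : ℝ) : ℂ) * I) := by
    rw [← h10, div_mul_cancel₀ _ hP1, mul_div_cancel_left₀ _ hQ1]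
  -- algebraicity
  have hI : I ∈ algebraicClosure ℚ ℂ := mem_algebraicClosure_iff.mpr
    (IsAlgebraic.of_pow two_pos (by rw [Complex.I_sq]; exact isAlgebraic_one.neg))
  have hA0 := loopAngle_eval_mem_algebraicClosure A hA 0
  have hA1 := loopAngle_eval_mem_algebraicClosure A hA 1
  have hB0 := loopAngle_eval_mem_algebraicClosure B hB 0
  have hB1 := loopAngle_eval_mem_algebraicClosure B hB 1
  simp only [Rat.cast_zero, Rat.cast_one] at hA0 hA1 hB0 hB1
  have hmem : exp (2 * ((T 1 : ℝ) : ℂ) * I) ∈ algebraicClosure ℚ ℂ := by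
    rw [hE]
    exact div_mem (mul_mem (div_mem (sub_mem hA0 (mul_mem hB0 hI))
      (add_mem hA0 (mul_mem hB0 hI))) (add_mem hA1 (mul_mem hB1 hI)))
      (sub_mem hA1 (mul_mem hB1 hI))
  refine IsAlgebraic.of_pow two_pos (mem_algebraicClosure_iff.mp ?_)
  have hsq : exp (((T 1 : ℝ) : ℂ) * I) ^ 2 = exp (2 * ((T 1 : ℝ) : ℂ) * I) := by
    rw [sq, ← Complex.exp_add]
    ring_nf
  rw [hsq]
  exact hmem

end Summit.KontsevichZagierPeriods.KontsevichZagierPeriods.Cruxes.StokesGeneration.FibrewiseStokes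

end
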